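import Literature.AlgebraicGeometry.Resolution.Lipman1969FormallySmoothBaseChange
import Literature.AlgebraicGeometry.Resolution.FlatLocalRegularAscentSeparable
import Literature.AlgebraicGeometry.Resolution.CompletedPullbackRegular
import Literature.AlgebraicGeometry.Resolution.SectionsOfBaseChange
import Literature.AlgebraicGeometry.Morphisms.IsoOverOpen
import Literature.AlgebraicGeometry.Morphisms.FormalFunctions
import Mathlib.RingTheory.Unramified.Field
import Mathlib.RingTheory.Ideal.GoingDown
import Mathlib.AlgebraicGeometry.Morphisms.UniversallyOpen
import Mathlib.AlgebraicGeometry.Noetherian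
import HarnessLib

/-!
# Lipman 1969, Lemma (16.1) (ii): desingularizations pull back along local-étale base change
# (PROOF of the named fact `Lipman1969_16_1_ii`)

Topic: `Literature/AlgebraicGeometry/Resolution`. THEOREM (PROVED HERE, no new definitions, no named
facts): `Lipman1969_16_1_ii_holds : Lipman1969_16_1_ii` — the named fact of
`Lipman1969FormallySmoothBaseChange` (J. Lipman, *Rational singularities…*, Publ. Math. IHÉS 36
(1969), Lemma (16.1) (ii), p. 231, proof p. 232), in the local-étale case typed there: `A → B` a flat
local homomorphism of Noetherian local rings with `𝔪_A B = 𝔪_B` and `κ(B)/κ(A)` separable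
algebraic, `A` reduced; then for every desingularization `g : Y → Spec A`, `B` is reduced and
`g_B : Y ×_A Spec B → Spec B` is a desingularization.

Proof (Lipman's, p. 232), as sub-lemmas:
* (R2) `isRegular_pullback_of_isSeparable` — `Z = Y ×_A Spec B` is regular: every point of `Z`
  specialises to a point `z₀` over the closed point of `Spec B` (properness); on an affine chart
  `Spec (Γ(Y,W) ⊗_A B)` the local ring at `z₀` is regular by the ring-theoretic step
  `isRegularLocalRing_localization_tensor_of_isSeparable` (file `FlatLocalRegularAscentSeparable`:
  the fibre of `𝒪_{Y,y} → 𝒪_{Z,z₀}` is a field, Matsumura 23.7 (ii)); regularity generises.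
* (S5a) `algebraMapΓ_injective_of_isBirational` — `A ↪ Γ(Y, 𝒪_Y)` for `A` reduced, `g` birational;
  (S5b) `algebraMapΓ_pullback_snd_injective` — flat base change of sections, so `B ↪ Γ(Z, 𝒪_Z)`;
  (S5c) `isReduced_of_injective_algebraMapΓ` — hence `B` is reduced (`Z` regular ⇒ reduced).
* (L2)–(L4), (S6) `IsBirational.pullback_snd_of_flat` — birationality survives the flat base change
  (generic points go to generic points; `isIso_morphismRestrict_pullback_snd`); properness by base
  change.
Scheme part and assembly written by the critic seat res-inputs-crit-1 (skeleton f7dea37d9be7ab7a,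
candidates/, 2026-08-28); ring part by res-inputs-p-5a. Resolution of singularities in dimension ≥ 4 or
in positive characteristic is NOT proved by anything here.

## References

* J. Lipman, *Rational singularities, with applications to algebraic surfaces and unique
  factorization*, Publ. Math. IHÉS 36 (1969) 195–279, Lemma (16.1) (ii) (p. 231; proof p. 232).
  [Lipman1969]
* H. Matsumura, *Commutative Ring Theory*, CUP 1986, Thm. 23.7 (ii). [Matsumura1987]
* The Stacks Project, Tag 01RN (birational base change bookkeeping). [StacksProject]
-/

noncomputable section

open CategoryTheory CategoryTheory.Limits AlgebraicGeometry TopologicalSpace IsLocalRing TensorProduct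
open Literature.AlgebraicGeometry.Morphisms

universe u

namespace Literature.AlgebraicGeometry.Resolution

namespace Lipman1969_16_1_ii_holds_aux

/-- (R2) `Z = Y ×_A Spec B` is regular: copy of `isRegular_pullback_of_closedFibre` with step 4 replaced by
(ASCENT′). [cite: Lipman1969, Lemma (16.1) (p. 232, "Z is regular")] -/
theorem isRegular_pullback_of_isSeparable {A B : Type u} [CommRing A] [CommRing B]
    [IsNoetherianRing B] [IsLocalRing A] [IsLocalRing B] [Algebra A B]
    [IsLocalHom (algebraMap A B)] [Module.Flat A B]
    (hmax : (maximalIdeal A).map (algebraMap A B) = maximalIdeal B)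
    [Algebra.IsSeparable (ResidueField A) (ResidueField B)]
    {Y : Scheme.{u}} (q : Y ⟶ Spec (.of A)) [UniversallyClosed q] [LocallyOfFiniteType q]
    (hY : Scheme.IsRegular Y) : Scheme.IsRegular (pullback q (specOfAlgebra A B)) := by
  intro z
  set p₁ := pullback.fst q (specOfAlgebra A B) with hp₁
  set p₂ := pullback.snd q (specOfAlgebra A B) with hp₂
  -- Step 1: a specialisation `z₀` of `z` over the closed point of `Spec B`
  have hclosed : IsClosed (p₂ '' closure {z}) := p₂.isClosedMap _ isClosed_closure
  have hmem : (closedPoint B : ↥(Spec (CommRingCat.of B))) ∈ p₂ '' closure {z} := by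
    have hz : p₂ z ∈ p₂ '' closure {z} := ⟨z, subset_closure rfl, rfl⟩
    exact (specializes_closedPoint (R := B) (p₂ z)).mem_closed hclosed hz
  obtain ⟨z₀, hz₀, hz₀c⟩ := hmem
  have hspec : z ⤳ z₀ := specializes_iff_mem_closure.mpr hz₀
  -- Step 2: an affine chart around `z₀`
  obtain ⟨W, hW, hyW, -⟩ := exists_isAffineOpen_mem_and_subset (X := Y) (x := p₁ z₀) (U := ⊤)
    trivial
  let iW : Spec Γ(Y, W) ⟶ Y := hW.fromSpec
  let φ : CommRingCat.of A ⟶ Γ(Y, W) := Spec.preimage (iW ≫ q)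
  letI : Algebra A Γ(Y, W) := φ.hom.toAlgebra
  have hi : iW ≫ q = Spec.map (CommRingCat.ofHom (algebraMap A Γ(Y, W))) := by
    rw [RingHom.algebraMap_toAlgebra, CommRingCat.ofHom_hom, Spec.map_preimage]
  haveI : Algebra.FiniteType A Γ(Y, W) := by
    have h1 : LocallyOfFiniteType (Spec.map (CommRingCat.ofHom (algebraMap A Γ(Y, W)))) := by
      rw [← hi]; infer_instance
    have h2 := (HasRingHomProperty.Spec_iff (P := @LocallyOfFiniteType)).mp h1
    exact RingHom.finiteType_algebraMap.mp h2
  haveI : IsNoetherianRing (Γ(Y, W) ⊗[A] B) := isNoetherianRing_tensor_of_finiteType B Γ(Y, W)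
  let c := specTensorChart B q iW hi
  have hz₀range : z₀ ∈ Set.range c := by
    change z₀ ∈ Set.range (specTensorChart B q iW hi)
    rw [range_specTensorChart, Set.mem_preimage, IsAffineOpen.range_fromSpec]
    exact hyW
  obtain ⟨ζ₀, hζ₀⟩ := hz₀range
  have hzrange : z ∈ Set.range c :=
    hspec.mem_open c.isOpenEmbedding.isOpen_range ⟨ζ₀, hζ₀⟩
  obtain ⟨ζ, hζ⟩ := hzrange
  have hle : @LE.le (PrimeSpectrum _) _ ζ ζ₀ := by
    rw [PrimeSpectrum.le_iff_specializes]
    have h1 : c ζ ⤳ c ζ₀ := by rw [hζ, hζ₀]; exact hspec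
    exact c.isOpenEmbedding.isInducing.specializes_iff.mp h1
  -- Step 3: the prime `ζ₀` lies over the closed point of `B`
  have hζ₀max : maximalIdeal B ≤ ζ₀.asIdeal.comap
      (Algebra.TensorProduct.includeRight (R := A) (A := Γ(Y, W)) (B := B)).toRingHom := by
    have h1 : p₂ (c ζ₀) = closedPoint B := by rw [hζ₀]; exact hz₀c
    rw [← Scheme.Hom.comp_apply] at h1
    change (specTensorChart B q iW hi ≫ pullback.snd q (specOfAlgebra A B)) ζ₀ = closedPoint B at h1
    rw [specTensorChart_snd, Spec.map_apply] at h1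
    have h2 := congrArg PrimeSpectrum.asIdeal h1
    rw [PrimeSpectrum.comap_asIdeal] at h2
    change Ideal.comap _ ζ₀.asIdeal = maximalIdeal B at h2
    exact h2.ge
  -- Step 4: `Γ(Y, W)_{ζ₀ ∩ Γ(Y, W)}` is regular (a local ring of `Y`), hence so is the chart ring at `ζ₀`
  have hreg₀ : IsRegularLocalRing (Localization.AtPrime
      (ζ₀.asIdeal.comap (algebraMap Γ(Y, W) (Γ(Y, W) ⊗[A] B)))) := by
    let η : PrimeSpectrum Γ(Y, W) := PrimeSpectrum.comap (algebraMap Γ(Y, W) (Γ(Y, W) ⊗[A] B)) ζ₀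
    have hη : IsRegularLocalRing ((Spec Γ(Y, W)).presheaf.stalk η) :=
      (isRegularLocalRing_stalk_iff_of_isOpenImmersion iW η).mp (hY _)
    exact (isRegularLocalRing_stalk_Spec_iff Γ(Y, W) η).mp hη
  have hregζ₀ : IsRegularLocalRing (Localization.AtPrime ζ₀.asIdeal) :=
    isRegularLocalRing_localization_tensor_of_isSeparable hmax ζ₀.asIdeal hζ₀max hreg₀
  -- Step 5: generise to `ζ` and transport to `z`
  have hregζ : IsRegularLocalRing (Localization.AtPrime ζ.asIdeal) := by
    have := mem_regularLocus_of_le hle ((mem_regularLocus ζ₀).mpr hregζ₀)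
    exact (mem_regularLocus ζ).mp this
  rw [← hζ]
  exact (isRegularLocalRing_stalk_iff_of_isOpenImmersion c ζ).mpr
    ((isRegularLocalRing_stalk_Spec_iff _ ζ).mpr hregζ)

/-- (S5a) For `A` reduced and `g : Y → Spec A` birational, `A → Γ(Y, 𝒪_Y)` is injective: an
element `a` dying on `Y` dies on `g⁻¹U ≅ U`, so `D(a) ∩ U = ∅`; `U` dense forces `D(a) = ∅`, i.e. `a`
nilpotent, hence `0`. (No Noetherian hypothesis is needed.)
[cite: Lipman1969, Lemma (16.1) (p. 232, "B is reduced")] -/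
theorem algebraMapΓ_injective_of_isBirational {A : Type u} [CommRing A] [IsReduced A]
    {Y : Scheme.{u}} (g : Y ⟶ Spec (.of A)) (hg : IsBirational g) :
    Function.Injective (algebraMapΓ g) := by
  rw [injective_iff_map_eq_zero]
  intro a ha
  obtain ⟨U, hU, -, hiso⟩ := hg
  set t : Γ(Spec (CommRingCat.of A), ⊤) := (Scheme.ΓSpecIso (.of A)).inv a with ht
  have hat : algebraMapΓ g a = g.appTop t := rfl
  -- the restriction of `t` to `V := U.ι '' ⊤ = U` is killed by `g.app V`, which is an isomorphism
  have hle : U.ι ''ᵁ ⊤ ≤ (⊤ : (Spec (CommRingCat.of A)).Opens) := le_top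
  have h1 : g.app (U.ι ''ᵁ ⊤) ((Spec (CommRingCat.of A)).presheaf.map (homOfLE hle).op t) = 0 := by
    have e := congrArg (fun φ => φ.hom t) (g.naturality (homOfLE hle).op)
    simp only [CommRingCat.hom_comp, RingHom.coe_comp, Function.comp_apply] at e
    rw [e]
    change Y.presheaf.map _ (g.appTop t) = 0
    rw [← hat, ha, map_zero]
  haveI : IsIso (g.app (U.ι ''ᵁ ⊤)) := by
    haveI := hiso
    have h2 : IsIso ((g ∣_ U).app ⊤) := inferInstance
    rw [show (g ∣_ U).app ⊤ = (g ∣_ U).appTop from rfl, morphismRestrict_appTop] at h2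
    exact @IsIso.of_isIso_comp_right _ _ _ _ _ (g.app (U.ι ''ᵁ ⊤))
      (Y.presheaf.map (eqToHom (image_morphismRestrict_preimage g U ⊤)).op) _ h2
  have h3 : (Spec (CommRingCat.of A)).presheaf.map (homOfLE hle).op t = 0 := by
    have hinj := (ConcreteCategory.bijective_of_isIso (g.app (U.ι ''ᵁ ⊤))).1
    apply hinj
    rw [h1, map_zero]
  -- hence `D(t) ∩ U = ∅`, and `U` being dense, `D(t) = ∅`
  have h4 : (U.ι ''ᵁ ⊤) ⊓ (Spec (CommRingCat.of A)).basicOpen t = ⊥ := by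
    rw [← Scheme.basicOpen_res _ t (homOfLE hle).op, h3, Scheme.basicOpen_zero]
  rw [Scheme.Opens.ι_image_top] at h4
  have h5 : (Spec (CommRingCat.of A)).basicOpen t = ⊥ := by
    by_contra hne
    have hne' : (((Spec (CommRingCat.of A)).basicOpen t : (Spec (CommRingCat.of A)).Opens) :
        Set (Spec (CommRingCat.of A))).Nonempty := by
      rw [Set.nonempty_iff_ne_empty]
      intro h
      exact hne (TopologicalSpace.Opens.coe_inj.mp (by simpa using h))
    obtain ⟨x, hxU, hxt⟩ := hU.exists_mem_open ((Spec (CommRingCat.of A)).basicOpen t).isOpen hne'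
    have hx : x ∈ (U ⊓ (Spec (CommRingCat.of A)).basicOpen t : (Spec (CommRingCat.of A)).Opens) :=
      ⟨hxU, hxt⟩
    rw [h4] at hx
    exact hx
  -- so `a` is nilpotent, hence zero
  have h6 : (PrimeSpectrum.basicOpen a : TopologicalSpace.Opens (PrimeSpectrum A)) = ⊥ := by
    have e := basicOpen_eq_of_affine (R := CommRingCat.of A) a
    rw [← ht, h5] at e
    exact e.symm
  exact ((PrimeSpectrum.basicOpen_eq_bot_iff a).mp h6).eq_zero

/-- (S5b) Flat base change of sections: `B → Γ(Y ×_A Spec B, 𝒪)` is injective when `A → Γ(Y, 𝒪)` is and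
`B` is `A`-flat (`Γ(Z, 𝒪) ≅ Γ(Spec B) ⊗_{Γ(Spec A)} Γ(Y, 𝒪)`, `exists_ringEquiv_tensor_sections_pullback`).
[folklore] -/
private theorem algebraMapΓ_pullback_snd_injective {A B : Type u} [CommRing A] [CommRing B] [Algebra A B]
    [Module.Flat A B] {Y : Scheme.{u}} (g : Y ⟶ Spec (.of A)) [QuasiCompact g] [QuasiSeparated g]
    (hinj : Function.Injective (algebraMapΓ g)) :
    Function.Injective (algebraMapΓ (pullback.snd g (specOfAlgebra A B))) := by
  have hflat : Flat (specOfAlgebra A B) :=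
    (HasRingHomProperty.Spec_iff (P := @Flat)).mpr (RingHom.flat_algebraMap_iff.mpr inferInstance)
  have hUV : (⊤ : (Spec (CommRingCat.of B)).Opens) ≤ (specOfAlgebra A B) ⁻¹ᵁ ⊤ := le_top
  letI i1 : Algebra Γ(Spec (CommRingCat.of A), ⊤) Γ(Y, g ⁻¹ᵁ ⊤) := (g.app ⊤).hom.toAlgebra
  letI i2 : Algebra Γ(Spec (CommRingCat.of A), ⊤) Γ(Spec (CommRingCat.of B), ⊤) :=
    ((specOfAlgebra A B).appLE ⊤ ⊤ hUV).hom.toAlgebra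
  obtain ⟨e, he1, -⟩ :=
    exists_ringEquiv_tensor_sections_pullback g (specOfAlgebra A B) (isAffineOpen_top _) hUV
  haveI : Module.Flat Γ(Spec (CommRingCat.of A), ⊤) Γ(Spec (CommRingCat.of B), ⊤) :=
    HasRingHomProperty.appLE (P := @Flat) _ hflat ⟨⊤, isAffineOpen_top _⟩ ⟨⊤, isAffineOpen_top _⟩ hUV
  have hinj' : Function.Injective (algebraMap Γ(Spec (CommRingCat.of A), ⊤) Γ(Y, g ⁻¹ᵁ ⊤)) := by
    change Function.Injective (g.app ⊤).hom
    have h2 : ((g.app ⊤).hom : Γ(Spec (CommRingCat.of A), ⊤) → Γ(Y, g ⁻¹ᵁ ⊤)) =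
        fun a => algebraMapΓ g ((Scheme.ΓSpecIso (.of A)).hom a) := by
      funext a
      simp [algebraMapΓ]
      rfl
    rw [h2]
    exact hinj.comp (Scheme.ΓSpecIso (.of A)).commRingCatIsoToRingEquiv.injective
  have h3 := Algebra.TensorProduct.includeLeft_injective (R := Γ(Spec (CommRingCat.of A), ⊤))
    (S := Γ(Spec (CommRingCat.of A), ⊤)) (A := Γ(Spec (CommRingCat.of B), ⊤)) (B := Γ(Y, g ⁻¹ᵁ ⊤))
    hinj'
  have h4 : (algebraMapΓ (pullback.snd g (specOfAlgebra A B)) : B → _) = fun b =>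
      e (Algebra.TensorProduct.includeLeft (R := Γ(Spec (CommRingCat.of A), ⊤))
        (S := Γ(Spec (CommRingCat.of A), ⊤)) (B := Γ(Y, g ⁻¹ᵁ ⊤))
        ((Scheme.ΓSpecIso (.of B)).inv b)) := by
    funext b
    rw [Algebra.TensorProduct.includeLeft_apply, he1]
    rfl
  rw [h4]
  exact e.injective.comp (h3.comp (Scheme.ΓSpecIso (.of B)).commRingCatIsoToRingEquiv.symm.injective)

/-- (S5c) A ring embedding into the global sections of a regular (hence reduced) scheme is reduced.
[folklore] -/
private theorem isReduced_of_injective_algebraMapΓ {B : Type u} [CommRing B] {Z : Scheme.{u}}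
    (h : Z ⟶ Spec (.of B)) (hZ : Scheme.IsRegular Z) (hinj : Function.Injective (algebraMapΓ h)) :
    IsReduced B := by
  haveI : ∀ z : Z, _root_.IsReduced (Z.presheaf.stalk z) := fun z => by
    haveI := hZ z
    haveI := isDomain_of_isRegularLocalRing (Z.presheaf.stalk z)
    infer_instance
  haveI : AlgebraicGeometry.IsReduced Z := isReduced_of_isReduced_stalk Z
  exact isReduced_of_injective (algebraMapΓ h) hinj

/-- (L2) In a Noetherian sober space, a maximal point (one with no proper generization) lies in
every dense open subset: the union of the irreducible components not containing it is closed and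
misses it. [folklore] -/
private theorem mem_of_dense_of_forall_specializes {T : Type*} [TopologicalSpace T]
    [NoetherianSpace T] [QuasiSober T] {V : Set T} (hVo : IsOpen V) (hV : Dense V) {y : T}
    (hy : ∀ y', y' ⤳ y → y' = y) : y ∈ V := by
  set F : Set (Set T) := {C | C ∈ irreducibleComponents T ∧ y ∉ C} with hF
  have hFfin : F.Finite :=
    TopologicalSpace.NoetherianSpace.finite_irreducibleComponents.subset fun C hC => hC.1
  have hWo : IsOpen (⋃ C ∈ F, C)ᶜ := by
    rw [isOpen_compl_iff]
    exact hFfin.isClosed_biUnion fun C hC => isClosed_of_mem_irreducibleComponents C hC.1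
  have hyW : y ∈ (⋃ C ∈ F, C)ᶜ := by
    simp only [Set.mem_compl_iff, Set.mem_iUnion, not_exists]
    exact fun C hC hyC => hC.2 hyC
  obtain ⟨r, hrV, hrW⟩ := hV.exists_mem_open hWo ⟨y, hyW⟩
  have hyC : y ∈ irreducibleComponent r := by
    by_contra h
    apply hrW
    simp only [Set.mem_iUnion]
    exact ⟨irreducibleComponent r, ⟨irreducibleComponent_mem_irreducibleComponents r, h⟩,
      mem_irreducibleComponent⟩
  obtain ⟨η, hη⟩ :=
    QuasiSober.sober (isIrreducible_irreducibleComponent (x := r)) isClosed_irreducibleComponent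
  have hηy : η = y := hy η (hη.specializes hyC)
  have hyr : y ⤳ r := hηy ▸ hη.specializes mem_irreducibleComponent
  exact hyr.mem_open hVo hrV

/-- (L4) The preimage of a dense open subset of a Noetherian sober space under a generalizing map is
dense, provided every point of the source specializes from a maximal point. [folklore] -/
private theorem dense_preimage_of_generalizingMap {S T : Type*} [TopologicalSpace S]
    [TopologicalSpace T] [NoetherianSpace T] [QuasiSober T] {f : S → T} (hf : GeneralizingMap f)
    {V : Set T} (hVo : IsOpen V) (hV : Dense V)
    (hS : ∀ s : S, ∃ s₀ : S, s₀ ⤳ s ∧ ∀ s', s' ⤳ s₀ → s' = s₀) : Dense (f ⁻¹' V) := by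
  intro s
  obtain ⟨s₀, hs₀s, hmax⟩ := hS s
  have hmax' : ∀ y', y' ⤳ f s₀ → y' = f s₀ := by
    intro y' hy'
    obtain ⟨s', hs', rfl⟩ := hf hy'
    rw [hmax s' hs']
  have h0 : s₀ ∈ f ⁻¹' V := mem_of_dense_of_forall_specializes hVo hV hmax'
  exact closure_mono (Set.singleton_subset_iff.mpr h0) (specializes_iff_mem_closure.mp hs₀s)

/-- (L3) Every point of a scheme specializes from a maximal point (the generic point of an
irreducible component through it): take a minimal prime below it in an affine chart. [folklore] -/
private theorem exists_forall_specializes_eq {X : Scheme.{u}} (x : X) :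
    ∃ x₀ : X, x₀ ⤳ x ∧ ∀ x', x' ⤳ x₀ → x' = x₀ := by
  obtain ⟨W, hW, hxW, -⟩ := exists_isAffineOpen_mem_and_subset (X := X) (x := x) (U := ⊤) trivial
  set p := hW.primeIdealOf ⟨x, hxW⟩ with hp
  obtain ⟨q, hqmin, hqp⟩ :=
    Ideal.exists_minimalPrimes_le (show (⊥ : Ideal Γ(X, W)) ≤ p.asIdeal from bot_le)
  haveI hqprime : q.IsPrime := hqmin.1.1
  let q' : PrimeSpectrum Γ(X, W) := ⟨q, hqprime⟩
  refine ⟨hW.fromSpec.base q', ?_, ?_⟩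
  · have h1 : q' ⤳ p := (PrimeSpectrum.le_iff_specializes q' p).mp hqp
    have h2 := h1.map hW.fromSpec.base.hom.continuous
    have h3 : hW.fromSpec.base.hom p = x := hW.fromSpec_primeIdealOf ⟨x, hxW⟩
    rwa [h3] at h2
  · intro x' hx'
    have hmem : hW.fromSpec.base q' ∈ (W : Set X) := by
      rw [← hW.range_fromSpec]; exact ⟨q', rfl⟩
    have hx'W : x' ∈ (W : Set X) := hx'.mem_open W.2 hmem
    rw [← hW.range_fromSpec] at hx'W
    obtain ⟨r, rfl⟩ := hx'W
    have h3 : r ⤳ q' := hW.fromSpec.isOpenEmbedding.isInducing.specializes_iff.mp hx'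
    have h4 : r.asIdeal ≤ q := (PrimeSpectrum.le_iff_specializes r q').mpr h3
    have hqmin' : Minimal (fun q : Ideal Γ(X, W) => q.IsPrime ∧ ⊥ ≤ q) q := hqmin
    have h5 : r.asIdeal = q := hqmin'.eq_of_le ⟨r.isPrime, bot_le⟩ h4
    have h6 : r = q' := PrimeSpectrum.ext h5
    rw [h6]

/-- (S6) Birationality survives flat affine base change over a Noetherian base: `U_B = i⁻¹U` and
its preimage in `Z = Y ×_A Spec B` are dense because `Spec B → Spec A` and `Z → Y` are flat, hence
generalizing, so maximal points map to maximal points, which lie in the dense opens `U`, `g⁻¹U`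
of the Noetherian spaces `Spec A`, `Y`; and `Z → Spec B` is an isomorphism over `U_B`
(`isIso_morphismRestrict_pullback_snd`). (`B` Noetherian is not needed.)
[cite: StacksProject, Tag 01RN] -/
theorem IsBirational.pullback_snd_of_flat {A B : Type u} [CommRing A] [CommRing B]
    [IsNoetherianRing A] [Algebra A B] [Module.Flat A B] {Y : Scheme.{u}}
    (g : Y ⟶ Spec (.of A)) [QuasiCompact g] [LocallyOfFiniteType g] (hg : IsBirational g) :
    IsBirational (pullback.snd g (specOfAlgebra A B)) := by
  obtain ⟨U, hU, hU', hiso⟩ := hg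
  have hflat : Flat (specOfAlgebra A B) :=
    (HasRingHomProperty.Spec_iff (P := @Flat)).mpr (RingHom.flat_algebraMap_iff.mpr inferInstance)
  refine ⟨(specOfAlgebra A B) ⁻¹ᵁ U, ?_, ?_, ?_⟩
  · exact dense_preimage_of_generalizingMap (Flat.generalizingMap (specOfAlgebra A B)) U.2 hU
      exists_forall_specializes_eq
  · have heq : (pullback.snd g (specOfAlgebra A B)) ⁻¹ᵁ ((specOfAlgebra A B) ⁻¹ᵁ U) =
        (pullback.fst g (specOfAlgebra A B)) ⁻¹ᵁ (g ⁻¹ᵁ U) := by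
      rw [← Scheme.Hom.comp_preimage, ← Scheme.Hom.comp_preimage, pullback.condition]
    rw [heq]
    haveI : IsLocallyNoetherian Y := LocallyOfFiniteType.isLocallyNoetherian g
    haveI : CompactSpace Y := QuasiCompact.compactSpace_of_compactSpace g
    haveI : IsNoetherian Y := ⟨⟩
    exact dense_preimage_of_generalizingMap
      (Flat.generalizingMap (pullback.fst g (specOfAlgebra A B))) (g ⁻¹ᵁ U).2 hU'
      exists_forall_specializes_eq
  · haveI := hiso
    exact isIso_morphismRestrict_pullback_snd g (specOfAlgebra A B) U

end Lipman1969_16_1_ii_holds_aux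

open Lipman1969_16_1_ii_holds_aux in
/-- **Lipman 1969, Lemma (16.1) (ii)** (local-étale case, as typed in `Lipman1969_16_1_ii`): for
`A → B` a flat local homomorphism of Noetherian local rings with `𝔪_A B = 𝔪_B` and `κ(B)/κ(A)`
separable algebraic, `A` reduced, and `g : Y → Spec A` a desingularization, `B` is reduced and
`g_B : Y ×_A Spec B → Spec B` is a desingularization. Assembly of (R2), (S5a–c), (S6).
[cite: Lipman1969, Lemma (16.1) (ii) (p. 231; proof p. 232)] -/
theorem Lipman1969_16_1_ii_holds : Lipman1969_16_1_ii.{u} := by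
  intro A B _ _ _ _ _ _ _ _ _ hred hmax hsep Y g hg
  haveI := hg.isProper
  haveI := hsep
  have hreg : Scheme.IsRegular (pullback g (specOfAlgebra A B)) :=
    isRegular_pullback_of_isSeparable hmax g hg.isRegular
  have hinj := algebraMapΓ_injective_of_isBirational g hg.isBirational
  have hinjB := algebraMapΓ_pullback_snd_injective (B := B) g hinj
  exact ⟨isReduced_of_injective_algebraMapΓ _ hreg hinjB,
    ⟨inferInstance, IsBirational.pullback_snd_of_flat g hg.isBirational, hreg⟩⟩

end Literature.AlgebraicGeometry.Resolution

end
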